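import Summits.Ventures.PercRepro.GenQFlatRows
import Summits.Ventures.PercRepro.GenQRankStepBounds
import Summits.Ventures.PercRepro.GenQRankSixBounds

/-!
# PercRepro — THE RANK-`5` ROWS (S7q) AND (R6b) WITHOUT `Core` (night-4, gen 21)

The rank-`5` twin of the solid-count row (S6q) `sum_solids_kappa4_le`: each rank-`5` `5`-subset of `G` lies in exactly
one rank-`5` flat (`card_rank_eq_eq_sum_flats`), and a rank-`5` flat with `s` points of `G` carries at least
`κ₅(s)/2 = (2·C(s, 5) − 4·C(s, 4) − C(s, 3))/2` of them — the rank-step bound `two_mul_choose_five_le` of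
`GenQRankStepBounds`, re-derived here from the EXPLICIT flat bounds (lines `≤ 3`, planes `≤ 6`, solids `≤ 10`,
rank-`5` flats `≤ 21`, rank-`6` flats `≤ 43`) through `sizeChain_seven_of_flats` instead of `Core M p`, so that the
two-level certificate modules (whose hypotheses are exactly these bounds) can state it.  `κ₅` is stated doubled
(`kappa5Two s = 2·C(s, 5) − 4·C(s, 4) − C(s, 3)`, truncated — `0` for `s ≤ 14`, `91, 896, 2176, 4080, 6783, 10488, 15428`
for `s = 15 … 21`) and the row against `2·C(|G|, 5)`, so that the LP builder's half-integer coefficients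
(`45.5` at `s = 15`, `3391.5` at `s = 19`) are exact after division by `2` in `ℚ`.  Imports `GenQFlatRows`
(`sum_flats_fn_eq`, `card_rank_eq_eq_sum_flats`), `GenQRankStepBounds` (`card_rkSets_top_ge`, `rkSets`) and
`GenQRankSixBounds` (`sizeChain_seven_of_flats`).
-/
namespace PercRepro.Night4

open Finset ThmH SixFour GenQ PerFlat Star NightThree

variable {α : Type} [DecidableEq α] {M : Matroid α} [M.Finite]

/-- **`2·C(s, 5) ≤ 2·N_{5,5} + 4·C(s, 4) + C(s, 3)`** for `X ⊆ F ∈ flatsQ M 5`, from the explicit flat bounds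
(the `Core`-free form of `two_mul_choose_five_le`). -/
theorem two_mul_choose_five_le_of_flats (hs : Simple M) (hline : ∀ L ∈ flatsQ M 2, L.card ≤ 3)
    (hplane : ∀ P ∈ flatsQ M 3, P.card ≤ 6) (hsolid : ∀ F ∈ flatsQ M 4, F.card ≤ 10)
    (hflat5 : ∀ F ∈ flatsQ M 5, F.card ≤ 21) (hflat6 : ∀ F ∈ flatsQ M 6, F.card ≤ 43) {X F : Finset α}
    (hF : F ∈ flatsQ M 5) (hXF : X ⊆ F) :
    2 * X.card.choose 5 ≤ 2 * (rkSets M X 5 5).card + 4 * X.card.choose 4 + X.card.choose 3 := by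
  have hX : X ⊆ gr M := hXF.trans (mem_flatsQ.1 hF).1
  have h := card_rkSets_top_ge hs (sizeChain_seven_of_flats hs hline hplane hsolid hflat5 hflat6) hF hXF hX
    (by norm_num) (by norm_num) (k := 5) (by norm_num) (by decide)
  simp only [Finset.sum_Ico_eq_sum_range, Finset.prod_Ico_eq_prod_range] at h
  norm_num [Finset.sum_range_succ, Finset.prod_range_succ, show fCore 4 = 10 from rfl, show fCore 1 = 3 from rfl,
    show fCore 2 = 3 from rfl, show fCore 3 = 6 from rfl] at h
  have h' : (2 : ℚ) * X.card.choose 5 ≤ 2 * (rkSets M X 5 5).card + 4 * X.card.choose 4 + X.card.choose 3 := by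
    linarith
  exact_mod_cast h'

/-- `κ₅(s) = 2·C(s, 5) − 4·C(s, 4) − C(s, 3)` (truncated subtraction): twice the rank-`5` knapsack of the core. -/
def kappa5Two (s : ℕ) : ℕ := 2 * s.choose 5 - 4 * s.choose 4 - s.choose 3

/-- **`κ₅(|F ∩ G|) ≤ 2·#{A ⊆ F ∩ G : |A| = 5, rk A = 5}`** on every rank-`5` flat `F`. -/
theorem kappa5Two_le_two_mul (hs : Simple M) (hline : ∀ L ∈ flatsQ M 2, L.card ≤ 3)
    (hplane : ∀ P ∈ flatsQ M 3, P.card ≤ 6) (hsolid : ∀ F ∈ flatsQ M 4, F.card ≤ 10)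
    (hflat5 : ∀ F ∈ flatsQ M 5, F.card ≤ 21) (hflat6 : ∀ F ∈ flatsQ M 6, F.card ≤ 43) {G F : Finset α}
    (hF : F ∈ flatsQ M 5) :
    kappa5Two (F ∩ G).card ≤
      2 * (((F ∩ G).powersetCard 5).filter (fun A : Finset α => M.eRk (A : Set α) = ((5 : ℕ) : ℕ∞))).card := by
  have h := two_mul_choose_five_le_of_flats hs hline hplane hsolid hflat5 hflat6 hF
    (Finset.inter_subset_left (s₂ := G))
  unfold rkSets at h
  unfold kappa5Two
  omega

/-- **THE ROW (S7q)**: `Σ_s κ₅(s)·NR 5 s ≤ 2·C(|G|, 5)` on a subset `G` of a simple matroid with the core's flat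
bounds — each rank-`5` `5`-subset of `G` lies in exactly one rank-`5` flat, and a rank-`5` flat with `s` points of `G`
carries `≥ κ₅(s)/2` of them. -/
theorem sum_flats_kappa5Two_le (hs : Simple M) (hline : ∀ L ∈ flatsQ M 2, L.card ≤ 3)
    (hplane : ∀ P ∈ flatsQ M 3, P.card ≤ 6) (hsolid : ∀ F ∈ flatsQ M 4, F.card ≤ 10)
    (hflat5 : ∀ F ∈ flatsQ M 5, F.card ≤ 21) (hflat6 : ∀ F ∈ flatsQ M 6, F.card ≤ 43) {G : Finset α}
    (hG : G ⊆ gr M) :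
    ∑ s ∈ Finset.range (G.card + 1), kappa5Two s * NR M G 5 s ≤ 2 * G.card.choose 5 := by
  rw [← sum_flats_fn_eq]
  calc ∑ F ∈ flatsQ M 5, kappa5Two (F ∩ G).card
      ≤ ∑ F ∈ flatsQ M 5, 2 * (((F ∩ G).powersetCard 5).filter
          (fun A : Finset α => M.eRk (A : Set α) = ((5 : ℕ) : ℕ∞))).card :=
        Finset.sum_le_sum (fun F hF => kappa5Two_le_two_mul hs hline hplane hsolid hflat5 hflat6 hF)
    _ = 2 * ((G.powersetCard 5).filter (fun A : Finset α => M.eRk (A : Set α) = ((5 : ℕ) : ℕ∞))).card := by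
        rw [← Finset.mul_sum, card_rank_eq_eq_sum_flats hG 5 5]
    _ ≤ 2 * (G.powersetCard 5).card := Nat.mul_le_mul_left 2 (Finset.card_filter_le _ _)
    _ = 2 * G.card.choose 5 := by rw [Finset.card_powersetCard]

/-- The values of `κ₅` on the core's range (`s ≤ 21`): `0` up to `s = 14`, then `91, 896, 2176, 4080, 6783, 10488, 15428`. -/
theorem kappa5Two_values : kappa5Two 14 = 0 ∧ kappa5Two 15 = 91 ∧ kappa5Two 16 = 896 ∧ kappa5Two 17 = 2176 ∧ kappa5Two 18 = 4080 ∧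
    kappa5Two 19 = 6783 ∧ kappa5Two 20 = 10488 ∧ kappa5Two 21 = 15428 := by
  refine ⟨?_, ?_, ?_, ?_, ?_, ?_, ?_, ?_⟩ <;> decide

/-- **`20·C(s, 6) ≤ 20·N_{5,6} + 50·C(s, 4) + 2·C(s, 3)`** for `X ⊆ F ∈ flatsQ M 5`, from the explicit flat bounds
(the `Core`-free form of `twenty_mul_choose_six_le`). -/
theorem twenty_mul_choose_six_le_of_flats (hs : Simple M) (hline : ∀ L ∈ flatsQ M 2, L.card ≤ 3)
    (hplane : ∀ P ∈ flatsQ M 3, P.card ≤ 6) (hsolid : ∀ F ∈ flatsQ M 4, F.card ≤ 10)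
    (hflat5 : ∀ F ∈ flatsQ M 5, F.card ≤ 21) (hflat6 : ∀ F ∈ flatsQ M 6, F.card ≤ 43) {X F : Finset α}
    (hF : F ∈ flatsQ M 5) (hXF : X ⊆ F) :
    20 * X.card.choose 6 ≤ 20 * (rkSets M X 5 6).card + 50 * X.card.choose 4 + 2 * X.card.choose 3 := by
  have hX : X ⊆ gr M := hXF.trans (mem_flatsQ.1 hF).1
  have h := card_rkSets_top_ge hs (sizeChain_seven_of_flats hs hline hplane hsolid hflat5 hflat6) hF hXF hX
    (by norm_num) (by norm_num) (k := 6) (by norm_num) (by decide)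
  simp only [Finset.sum_Ico_eq_sum_range, Finset.prod_Ico_eq_prod_range] at h
  norm_num [Finset.sum_range_succ, Finset.prod_range_succ, show fCore 4 = 10 from rfl, show fCore 1 = 3 from rfl,
    show fCore 2 = 3 from rfl, show fCore 3 = 6 from rfl] at h
  have h' : (20 : ℚ) * X.card.choose 6 ≤ 20 * (rkSets M X 5 6).card + 50 * X.card.choose 4 + 2 * X.card.choose 3 := by
    linarith
  exact_mod_cast h'

/-- `ρ₆(s) = 20·C(s, 6) − 50·C(s, 4) − 2·C(s, 3)` (truncated): twenty times the rank-`5` six-subset knapsack. -/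
def rho6Twenty (s : ℕ) : ℕ := 20 * s.choose 6 - 50 * s.choose 4 - 2 * s.choose 3

/-- **`ρ₆(|F ∩ G|) ≤ 20·#{A ⊆ F ∩ G : |A| = 6, rk A = 5}`** on every rank-`5` flat `F`. -/
theorem rho6Twenty_le_twenty_mul (hs : Simple M) (hline : ∀ L ∈ flatsQ M 2, L.card ≤ 3)
    (hplane : ∀ P ∈ flatsQ M 3, P.card ≤ 6) (hsolid : ∀ F ∈ flatsQ M 4, F.card ≤ 10)
    (hflat5 : ∀ F ∈ flatsQ M 5, F.card ≤ 21) (hflat6 : ∀ F ∈ flatsQ M 6, F.card ≤ 43) {G F : Finset α}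
    (hF : F ∈ flatsQ M 5) :
    rho6Twenty (F ∩ G).card ≤
      20 * (((F ∩ G).powersetCard 6).filter (fun A : Finset α => M.eRk (A : Set α) = ((6 - 1 : ℕ) : ℕ∞))).card := by
  show rho6Twenty (F ∩ G).card ≤
      20 * (((F ∩ G).powersetCard 6).filter (fun A : Finset α => M.eRk (A : Set α) = ((5 : ℕ) : ℕ∞))).card
  have h := twenty_mul_choose_six_le_of_flats hs hline hplane hsolid hflat5 hflat6 hF
    (Finset.inter_subset_left (s₂ := G))
  unfold rkSets at h
  unfold rho6Twenty
  omega

/-- **THE ROW (R6b), twenty-fold**: `20·#{|G ∖ S| < 6} + 20·#{|G ∖ S| = 6} + Σ_s ρ₆(s)·NR 5 s ≤ 20·DF₆ + 20·C(|G|, 6)`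
on a subset `G` of a simple matroid with the core's flat bounds (`DFq_add_choose_ge_of_flats` scaled by `20`, the
per-flat bound `rho6Twenty_le_twenty_mul`). -/
theorem DFq_add_choose_ge_rho6Twenty (hs : Simple M) (hline : ∀ L ∈ flatsQ M 2, L.card ≤ 3)
    (hplane : ∀ P ∈ flatsQ M 3, P.card ≤ 6) (hsolid : ∀ F ∈ flatsQ M 4, F.card ≤ 10)
    (hflat5 : ∀ F ∈ flatsQ M 5, F.card ≤ 21) (hflat6 : ∀ F ∈ flatsQ M 6, F.card ≤ 43) {G : Finset α}
    (hG : G ⊆ gr M) (q : ℕ) :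
    20 * ((Rq M G q).filter (fun S : Finset α => (G \ S).card < 6)).card +
      20 * ((Rq M G q).filter (fun S : Finset α => (G \ S).card = 6)).card +
      ∑ s ∈ Finset.range (G.card + 1), rho6Twenty s * NR M G 5 s ≤ 20 * DFq M G q 6 + 20 * G.card.choose 6 := by
  have h := DFq_add_choose_ge_of_flats (M := M) hG q 6 (by norm_num)
  have h2 : ∑ s ∈ Finset.range (G.card + 1), rho6Twenty s * NR M G 5 s ≤
      20 * ∑ F ∈ flatsQ M (6 - 1), (((F ∩ G).powersetCard 6).filter
        (fun A : Finset α => M.eRk (A : Set α) = ((6 - 1 : ℕ) : ℕ∞))).card := by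
    rw [Finset.mul_sum, ← sum_flats_fn_eq]
    exact Finset.sum_le_sum (fun F hF => rho6Twenty_le_twenty_mul hs hline hplane hsolid hflat5 hflat6 hF)
  omega

/-- The values of `ρ₆` on the core's range: `0` up to `s = 13`, then `9282, 30940, 68040, 127160, 216648, 346902,
530670, 783370` for `s = 14 … 21` (`20·ρ₆` with `ρ₆ = 464.1, 1547, 3402, 6358, 10832.4, 17345.1, 26533.5, 39168.5`). -/
theorem rho6Twenty_values : rho6Twenty 13 = 0 ∧ rho6Twenty 14 = 9282 ∧ rho6Twenty 15 = 30940 ∧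
    rho6Twenty 16 = 68040 ∧ rho6Twenty 17 = 127160 ∧ rho6Twenty 18 = 216648 ∧ rho6Twenty 19 = 346902 ∧
    rho6Twenty 20 = 530670 ∧ rho6Twenty 21 = 783370 := by
  refine ⟨?_, ?_, ?_, ?_, ?_, ?_, ?_, ?_, ?_⟩ <;> decide

end PercRepro.Night4
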